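import Summits.HodgeConjecture.HodgeConjecture.Theorems.HodgeLocusCensusSigmaFamilySmooth

/-!
# Hodge-locus census — THEOREM SM-∞, smoothness clause for EVERY cell family (2k′, d, k′−1), k′ ≥ 3, d ≥ 4, N ≥ 2d − 1,
# as ONE kernel-checked theorem (uniform in k′)

certified instances and evidence bearing on the general Hodge conjecture; no claim.

ENGINE B gen 35 (record `ENGINEB-g35.md` §1.7).  Setting of the anchor `HodgeLocusCensusSigmaFamilySmooth` (k′ = 3, 4; imported for
`block_xy_scaled`, `block_ab_scaled`, `pert`) with the coordinates indexed by naturals: `a b : ℂ` and `x y : ℕ → ℂ`, of which only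
`x 0, …, x (k−1), y 0, …, y (k−1)` occur (`k = k′ ≥ 3`); `d = e + 3 ≥ 4`;
`F₀ = Σ_{j<k} (y_j x_j^{e+2} + y_j^{e+3}) + a^{e+2} b + a b^{e+2}`,
`F₁ = −Σ_{j ≤ k−3} y_j x_{j+1}^{e+1} x_{j+2} − y_{k−2} x_0 x_{k−1}^{e+1} + a b x_0^{e} x_1` (the Σ-coupling), `F_N = N·F₀ + F₁`.
The hypotheses of `sigma_member_nonsingular` are `∂F_N/∂a`, `∂F_N/∂b`, and — for every `i < k` — `∂F_N/∂x_i`, `∂F_N/∂y_i`, each written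
as `N·(∂F₀) + (∂F₁)`; the `∂F₁` parts are spelled out by cases on the index (`i = 0`, `i = 1`, `2 ≤ i ≤ k−2`, `i = k−1` for `∂/∂x_i`;
`j ≤ k−3`, `j = k−2`, `j = k−1` for `∂/∂y_j`) with `if`-branches, since the coupling monomials touching `x_i` depend on the position of
`i` in the cycle `x_1 → x_2 → ⋯ → x_{k−1} → x_0`.  Conclusion: for `e ≥ 1` and real `N ≥ 2e + 5` they do not all vanish at a point with
`(a, b, x_0..x_{k−1}, y_0..y_{k−1}) ≠ 0`, i.e. `V(F_N) ⊂ ℙ^{2k+1}` is SMOOTH — for all k′ ≥ 3 at once.  For k = 3, …, 7 the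
hypotheses specialise (after deciding the `if`s) to those of `sigma_member_k3/k4_nonsingular` (anchor; kernel-checked below as two
`example`s deriving the anchor's statements verbatim from the uniform theorem) and of the K5–K7 sheets; the case split was checked against implementation B's polynomial gradient for k = 3..9 in exact arithmetic
(`gen35/check_smooth_partials_all.py`: 0 mismatches).  Proof = the anchor's: sup-norm coordinate, rescaled block bound ≥ m^{e+2}/2,
coupling bound ≤ (e+2)·m^{e+2}, `pert`.  Def-free; imports only the cell's anchor `HodgeLocusCensusSigmaFamilySmooth`.
-/

namespace Summit.HodgeConjecture.HodgeConjecture.HodgeLocus.Census.SigmaFamilySmoothAll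

open Summit.HodgeConjecture.HodgeConjecture.HodgeLocus.Census.SigmaFamilySmooth

/-- THEOREM SM-∞ (smoothness clause), every cell family `(2k, e+3, k−1)` with `k ≥ 3`: for `e ≥ 1`, real `N ≥ 2e + 5` and
`(a, b, x_0..x_{k−1}, y_0..y_{k−1}) ≠ 0`, the `2k + 2` partial derivatives of `F_N = N·F₀ + F₁` (listed as hypotheses, the `∂F₁`
parts by cases on the index) do not vanish simultaneously: `V(F_N) ⊂ ℙ^{2k+1}` is smooth. -/
theorem sigma_member_nonsingular (k : ℕ) (hk : 3 ≤ k) (e : ℕ) (he : 1 ≤ e) (N : ℝ) (hN : 2 * (e : ℝ) + 5 ≤ N)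
    (a b : ℂ) (x y : ℕ → ℂ)
    (hne : ¬ (a = 0 ∧ b = 0 ∧ ∀ i < k, x i = 0 ∧ y i = 0)) :
    ¬ ( (N : ℂ) * (b * (((e : ℂ) + 2) * a ^ (e + 1) + b ^ (e + 1))) + b * x 0 ^ e * x 1 = 0 ∧
        (N : ℂ) * (a * (a ^ (e + 1) + ((e : ℂ) + 2) * b ^ (e + 1))) + a * x 0 ^ e * x 1 = 0 ∧
        (∀ i < k, (N : ℂ) * (((e : ℂ) + 2) * x i ^ (e + 1) * y i) +
            (if i = 0 then -(y (k - 2) * x (k - 1) ^ (e + 1)) + (e : ℂ) * a * b * x 0 ^ (e - 1) * x 1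
             else if i = 1 then -(((e : ℂ) + 1) * y 0 * x 1 ^ e * x 2) + a * b * x 0 ^ e
             else if i + 1 < k then -(y (i - 2) * x (i - 1) ^ (e + 1)) - ((e : ℂ) + 1) * y (i - 1) * x i ^ e * x (i + 1)
             else -(y (k - 3) * x (k - 2) ^ (e + 1)) - ((e : ℂ) + 1) * y (k - 2) * x 0 * x (k - 1) ^ e) = 0) ∧
        (∀ j < k, (N : ℂ) * (x j ^ (e + 2) + ((e : ℂ) + 3) * y j ^ (e + 2)) +
            (if j + 3 ≤ k then -(x (j + 1) ^ (e + 1) * x (j + 2))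
             else if j + 2 = k then -(x 0 * x (k - 1) ^ (e + 1))
             else 0) = 0) ) := by
  rintro ⟨Ha, Hb, Hx, Hy⟩
  -- the sup norm m over the 2k+2 coordinates and an index attaining it
  let f : ℕ → ℝ := fun n => if n = 0 then ‖a‖ else if n = 1 then ‖b‖ else if n < k + 2 then ‖x (n - 2)‖ else ‖y (n - 2 - k)‖
  obtain ⟨n₀, hn₀, hmax⟩ := Finset.exists_max_image (Finset.range (2 * k + 2)) f ⟨0, by simp⟩
  have hn₀' : n₀ < 2 * k + 2 := Finset.mem_range.mp hn₀
  have key : ∀ n, n < 2 * k + 2 → f n ≤ f n₀ := fun n hn => hmax n (Finset.mem_range.mpr hn)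
  generalize hm_def : f n₀ = m at key
  have hA : ‖a‖ ≤ m := by have h := key 0 (by omega); simpa [f] using h
  have hB : ‖b‖ ≤ m := by have h := key 1 (by omega); simpa [f] using h
  have hX : ∀ i < k, ‖x i‖ ≤ m := by
    intro i hi
    have h := key (i + 2) (by omega)
    simp only [f, show ¬ (i + 2 = 0) from by omega, show ¬ (i + 2 = 1) from by omega, show i + 2 < k + 2 from by omega,
      if_false, if_true, Nat.add_sub_cancel] at h
    exact h
  have hY : ∀ i < k, ‖y i‖ ≤ m := by
    intro i hi
    have h := key (i + 2 + k) (by omega)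
    simp only [f, show ¬ (i + 2 + k = 0) from by omega, show ¬ (i + 2 + k = 1) from by omega,
      show ¬ (i + 2 + k < k + 2) from by omega, if_false, show i + 2 + k - 2 - k = i from by omega] at h
    exact h
  have hm : 0 < m := by
    by_contra hle
    have hle' : m ≤ 0 := not_lt.mp hle
    exact hne ⟨norm_le_zero_iff.mp (hA.trans hle'), norm_le_zero_iff.mp (hB.trans hle'),
      fun i hi => ⟨norm_le_zero_iff.mp ((hX i hi).trans hle'), norm_le_zero_iff.mp ((hY i hi).trans hle')⟩⟩
  -- numeric facts
  have heR : (0 : ℝ) ≤ (e : ℝ) := by positivity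
  have hM : (0 : ℝ) ≤ (e : ℝ) + 2 := by linarith
  have hN' : 2 * ((e : ℝ) + 2) < N := by linarith
  have hc : (0 : ℝ) < m ^ (e + 2) := pow_pos hm _
  have hpow3 : m ^ (e + 2) = m * m * m ^ (e - 1) * m := by rw [show e + 2 = (e - 1) + 3 by omega]; ring
  have hne1 : ‖((e : ℂ) + 1)‖ = (e : ℝ) + 1 := by
    rw [show ((e : ℂ) + 1) = (((e + 1 : ℕ)) : ℂ) by push_cast; ring, Complex.norm_natCast, Nat.cast_add, Nat.cast_one]
  have hk0 : 0 < k := by omega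
  have hk1 : 1 < k := by omega
  have hk2 : 2 < k := by omega
  -- coupling bounds ‖∂F₁/∂a‖, ‖∂F₁/∂b‖ ≤ (e+2) m^{e+2}
  have ca : ‖b * x 0 ^ e * x 1‖ ≤ ((e : ℝ) + 2) * m ^ (e + 2) := by
    calc ‖b * x 0 ^ e * x 1‖ = ‖b‖ * ‖x 0‖ ^ e * ‖x 1‖ := by rw [norm_mul, norm_mul, norm_pow]
      _ ≤ m * m ^ e * m := by gcongr; exacts [hX 0 hk0, hX 1 hk1]
      _ = 1 * m ^ (e + 2) := by ring
      _ ≤ ((e : ℝ) + 2) * m ^ (e + 2) := by gcongr; linarith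
  have cb : ‖a * x 0 ^ e * x 1‖ ≤ ((e : ℝ) + 2) * m ^ (e + 2) := by
    calc ‖a * x 0 ^ e * x 1‖ = ‖a‖ * ‖x 0‖ ^ e * ‖x 1‖ := by rw [norm_mul, norm_mul, norm_pow]
      _ ≤ m * m ^ e * m := by gcongr; exacts [hX 0 hk0, hX 1 hk1]
      _ = 1 * m ^ (e + 2) := by ring
      _ ≤ ((e : ℝ) + 2) * m ^ (e + 2) := by gcongr; linarith
  -- coupling bounds ‖∂F₁/∂x_i‖ ≤ (e+2) m^{e+2}, by position of i
  have cx : ∀ i < k, ‖(if i = 0 then -(y (k - 2) * x (k - 1) ^ (e + 1)) + (e : ℂ) * a * b * x 0 ^ (e - 1) * x 1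
             else if i = 1 then -(((e : ℂ) + 1) * y 0 * x 1 ^ e * x 2) + a * b * x 0 ^ e
             else if i + 1 < k then -(y (i - 2) * x (i - 1) ^ (e + 1)) - ((e : ℂ) + 1) * y (i - 1) * x i ^ e * x (i + 1)
             else -(y (k - 3) * x (k - 2) ^ (e + 1)) - ((e : ℂ) + 1) * y (k - 2) * x 0 * x (k - 1) ^ e)‖
             ≤ ((e : ℝ) + 2) * m ^ (e + 2) := by
    intro i hi
    split_ifs with h0 h1 h2
    · -- i = 0
      have t1 : ‖-(y (k - 2) * x (k - 1) ^ (e + 1))‖ ≤ m ^ (e + 2) := by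
        calc ‖-(y (k - 2) * x (k - 1) ^ (e + 1))‖ = ‖y (k - 2)‖ * ‖x (k - 1)‖ ^ (e + 1) := by
              rw [norm_neg, norm_mul, norm_pow]
          _ ≤ m * m ^ (e + 1) := by gcongr; exacts [hY (k - 2) (by omega), hX (k - 1) (by omega)]
          _ = m ^ (e + 2) := by ring
      have t2 : ‖(e : ℂ) * a * b * x 0 ^ (e - 1) * x 1‖ ≤ (e : ℝ) * m ^ (e + 2) := by
        calc ‖(e : ℂ) * a * b * x 0 ^ (e - 1) * x 1‖ = (e : ℝ) * ‖a‖ * ‖b‖ * ‖x 0‖ ^ (e - 1) * ‖x 1‖ := by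
              rw [norm_mul, norm_mul, norm_mul, norm_mul, norm_pow, Complex.norm_natCast]
          _ ≤ (e : ℝ) * m * m * m ^ (e - 1) * m := by gcongr; exacts [hX 0 hk0, hX 1 hk1]
          _ = (e : ℝ) * m ^ (e + 2) := by rw [hpow3]; ring
      calc _ ≤ ‖-(y (k - 2) * x (k - 1) ^ (e + 1))‖ + ‖(e : ℂ) * a * b * x 0 ^ (e - 1) * x 1‖ := norm_add_le _ _
        _ ≤ m ^ (e + 2) + (e : ℝ) * m ^ (e + 2) := add_le_add t1 t2
        _ ≤ ((e : ℝ) + 2) * m ^ (e + 2) := by nlinarith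
    · -- i = 1
      have t1 : ‖-(((e : ℂ) + 1) * y 0 * x 1 ^ e * x 2)‖ ≤ ((e : ℝ) + 1) * m ^ (e + 2) := by
        calc ‖-(((e : ℂ) + 1) * y 0 * x 1 ^ e * x 2)‖ = ((e : ℝ) + 1) * ‖y 0‖ * ‖x 1‖ ^ e * ‖x 2‖ := by
              rw [norm_neg, norm_mul, norm_mul, norm_mul, norm_pow, hne1]
          _ ≤ ((e : ℝ) + 1) * m * m ^ e * m := by gcongr; exacts [hY 0 hk0, hX 1 hk1, hX 2 hk2]
          _ = ((e : ℝ) + 1) * m ^ (e + 2) := by ring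
      have t2 : ‖a * b * x 0 ^ e‖ ≤ m ^ (e + 2) := by
        calc ‖a * b * x 0 ^ e‖ = ‖a‖ * ‖b‖ * ‖x 0‖ ^ e := by rw [norm_mul, norm_mul, norm_pow]
          _ ≤ m * m * m ^ e := by gcongr; exact hX 0 hk0
          _ = m ^ (e + 2) := by ring
      calc _ ≤ ‖-(((e : ℂ) + 1) * y 0 * x 1 ^ e * x 2)‖ + ‖a * b * x 0 ^ e‖ := norm_add_le _ _
        _ ≤ ((e : ℝ) + 1) * m ^ (e + 2) + m ^ (e + 2) := add_le_add t1 t2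
        _ = ((e : ℝ) + 2) * m ^ (e + 2) := by ring
    · -- 2 ≤ i ≤ k − 2
      have t1 : ‖-(y (i - 2) * x (i - 1) ^ (e + 1))‖ ≤ m ^ (e + 2) := by
        calc ‖-(y (i - 2) * x (i - 1) ^ (e + 1))‖ = ‖y (i - 2)‖ * ‖x (i - 1)‖ ^ (e + 1) := by
              rw [norm_neg, norm_mul, norm_pow]
          _ ≤ m * m ^ (e + 1) := by gcongr; exacts [hY (i - 2) (by omega), hX (i - 1) (by omega)]
          _ = m ^ (e + 2) := by ring
      have t2 : ‖((e : ℂ) + 1) * y (i - 1) * x i ^ e * x (i + 1)‖ ≤ ((e : ℝ) + 1) * m ^ (e + 2) := by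
        calc ‖((e : ℂ) + 1) * y (i - 1) * x i ^ e * x (i + 1)‖ = ((e : ℝ) + 1) * ‖y (i - 1)‖ * ‖x i‖ ^ e * ‖x (i + 1)‖ := by
              rw [norm_mul, norm_mul, norm_mul, norm_pow, hne1]
          _ ≤ ((e : ℝ) + 1) * m * m ^ e * m := by gcongr; exacts [hY (i - 1) (by omega), hX i hi, hX (i + 1) h2]
          _ = ((e : ℝ) + 1) * m ^ (e + 2) := by ring
      calc _ ≤ ‖-(y (i - 2) * x (i - 1) ^ (e + 1))‖ + ‖((e : ℂ) + 1) * y (i - 1) * x i ^ e * x (i + 1)‖ := norm_sub_le _ _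
        _ ≤ m ^ (e + 2) + ((e : ℝ) + 1) * m ^ (e + 2) := add_le_add t1 t2
        _ = ((e : ℝ) + 2) * m ^ (e + 2) := by ring
    · -- i = k − 1
      have t1 : ‖-(y (k - 3) * x (k - 2) ^ (e + 1))‖ ≤ m ^ (e + 2) := by
        calc ‖-(y (k - 3) * x (k - 2) ^ (e + 1))‖ = ‖y (k - 3)‖ * ‖x (k - 2)‖ ^ (e + 1) := by
              rw [norm_neg, norm_mul, norm_pow]
          _ ≤ m * m ^ (e + 1) := by gcongr; exacts [hY (k - 3) (by omega), hX (k - 2) (by omega)]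
          _ = m ^ (e + 2) := by ring
      have t2 : ‖((e : ℂ) + 1) * y (k - 2) * x 0 * x (k - 1) ^ e‖ ≤ ((e : ℝ) + 1) * m ^ (e + 2) := by
        calc ‖((e : ℂ) + 1) * y (k - 2) * x 0 * x (k - 1) ^ e‖ = ((e : ℝ) + 1) * ‖y (k - 2)‖ * ‖x 0‖ * ‖x (k - 1)‖ ^ e := by
              rw [norm_mul, norm_mul, norm_mul, norm_pow, hne1]
          _ ≤ ((e : ℝ) + 1) * m * m * m ^ e := by gcongr; exacts [hY (k - 2) (by omega), hX 0 hk0, hX (k - 1) (by omega)]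
          _ = ((e : ℝ) + 1) * m ^ (e + 2) := by ring
      calc _ ≤ ‖-(y (k - 3) * x (k - 2) ^ (e + 1))‖ + ‖((e : ℂ) + 1) * y (k - 2) * x 0 * x (k - 1) ^ e‖ := norm_sub_le _ _
        _ ≤ m ^ (e + 2) + ((e : ℝ) + 1) * m ^ (e + 2) := add_le_add t1 t2
        _ = ((e : ℝ) + 2) * m ^ (e + 2) := by ring
  -- coupling bounds ‖∂F₁/∂y_j‖ ≤ (e+2) m^{e+2}
  have cy : ∀ j < k, ‖(if j + 3 ≤ k then -(x (j + 1) ^ (e + 1) * x (j + 2))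
             else if j + 2 = k then -(x 0 * x (k - 1) ^ (e + 1)) else 0)‖ ≤ ((e : ℝ) + 2) * m ^ (e + 2) := by
    intro j hj
    split_ifs with h3 h2
    · calc ‖-(x (j + 1) ^ (e + 1) * x (j + 2))‖ = ‖x (j + 1)‖ ^ (e + 1) * ‖x (j + 2)‖ := by rw [norm_neg, norm_mul, norm_pow]
        _ ≤ m ^ (e + 1) * m := by gcongr; exacts [hX (j + 1) (by omega), hX (j + 2) (by omega)]
        _ = 1 * m ^ (e + 2) := by ring
        _ ≤ ((e : ℝ) + 2) * m ^ (e + 2) := by gcongr; linarith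
    · calc ‖-(x 0 * x (k - 1) ^ (e + 1))‖ = ‖x 0‖ * ‖x (k - 1)‖ ^ (e + 1) := by rw [norm_neg, norm_mul, norm_pow]
        _ ≤ m * m ^ (e + 1) := by gcongr; exacts [hX 0 hk0, hX (k - 1) (by omega)]
        _ = 1 * m ^ (e + 2) := by ring
        _ ≤ ((e : ℝ) + 2) * m ^ (e + 2) := by gcongr; linarith
    · rw [norm_zero]; positivity
  -- which coordinate attains the sup norm
  rcases Nat.lt_or_ge n₀ 2 with h01 | h2
  · have hab : ‖a‖ = m ∨ ‖b‖ = m := by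
      interval_cases n₀
      · left; simpa [f] using hm_def
      · right; simpa [f] using hm_def
    rcases block_ab_scaled e he a b m hm hA hB hab with h | h
    · exact pert N _ _ _ _ hc hM hN' h ca Ha
    · exact pert N _ _ _ _ hc hM hN' h cb Hb
  · rcases Nat.lt_or_ge n₀ (k + 2) with hx' | hy'
    · -- x (n₀ - 2) attains
      have hi : n₀ - 2 < k := by omega
      have h1 : ‖x (n₀ - 2)‖ = m := by
        simp only [f, show ¬ (n₀ = 0) from by omega, show ¬ (n₀ = 1) from by omega, hx', if_false, if_true] at hm_def
        exact hm_def
      rcases block_xy_scaled e he (x (n₀ - 2)) (y (n₀ - 2)) m hm (hX _ hi) (hY _ hi) (Or.inl h1) with h | h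
      · exact pert N _ _ _ _ hc hM hN' h (cx _ hi) (Hx _ hi)
      · exact pert N _ _ _ _ hc hM hN' h (cy _ hi) (Hy _ hi)
    · -- y (n₀ - 2 - k) attains
      have hi : n₀ - 2 - k < k := by omega
      have h1 : ‖y (n₀ - 2 - k)‖ = m := by
        simp only [f, show ¬ (n₀ = 0) from by omega, show ¬ (n₀ = 1) from by omega, show ¬ (n₀ < k + 2) from by omega,
          if_false] at hm_def
        exact hm_def
      rcases block_xy_scaled e he (x (n₀ - 2 - k)) (y (n₀ - 2 - k)) m hm (hX _ hi) (hY _ hi) (Or.inr h1) with h | h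
      · exact pert N _ _ _ _ hc hM hN' h (cx _ hi) (Hx _ hi)
      · exact pert N _ _ _ _ hc hM hN' h (cy _ hi) (Hy _ hi)

/- CONSISTENCY WITH THE ANCHOR, k′ = 3 (an `example`, kernel-checked at build time, no declaration — the statement below is
anchor 62's `sigma_member_k3_nonsingular` verbatim, which the gate's dedup lint forbids restating as a theorem): the uniform theorem at `k = 3` (with `x, y` the coordinate functions of
`(x0, x1, x2)`, `(y0, y1, y2)`) yields the statement of `sigma_member_k3_nonsingular` verbatim — a kernel check that the
`if`-branch case split specialises to the hand-audited k′ = 3 partial derivatives. -/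
example (e : ℕ) (he : 1 ≤ e) (N : ℝ) (hN : 2 * (e : ℝ) + 5 ≤ N)
    (a b x0 x1 x2 y0 y1 y2 : ℂ)
    (hne : ¬ (a = 0 ∧ b = 0 ∧ x0 = 0 ∧ x1 = 0 ∧ x2 = 0 ∧ y0 = 0 ∧ y1 = 0 ∧ y2 = 0)) :
    ¬ ( (N : ℂ) * (b * (((e : ℂ) + 2) * a ^ (e + 1) + b ^ (e + 1))) + b * x0 ^ e * x1 = 0 ∧
        (N : ℂ) * (a * (a ^ (e + 1) + ((e : ℂ) + 2) * b ^ (e + 1))) + a * x0 ^ e * x1 = 0 ∧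
        (N : ℂ) * (((e : ℂ) + 2) * x0 ^ (e + 1) * y0) + (-(y1 * x2 ^ (e + 1)) + (e : ℂ) * a * b * x0 ^ (e - 1) * x1) = 0 ∧
        (N : ℂ) * (((e : ℂ) + 2) * x1 ^ (e + 1) * y1) + (-(((e : ℂ) + 1) * y0 * x1 ^ e * x2) + a * b * x0 ^ e) = 0 ∧
        (N : ℂ) * (((e : ℂ) + 2) * x2 ^ (e + 1) * y2) + (-(y0 * x1 ^ (e + 1)) - ((e : ℂ) + 1) * y1 * x0 * x2 ^ e) = 0 ∧
        (N : ℂ) * (x0 ^ (e + 2) + ((e : ℂ) + 3) * y0 ^ (e + 2)) + (-(x1 ^ (e + 1) * x2)) = 0 ∧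
        (N : ℂ) * (x1 ^ (e + 2) + ((e : ℂ) + 3) * y1 ^ (e + 2)) + (-(x0 * x2 ^ (e + 1))) = 0 ∧
        (N : ℂ) * (x2 ^ (e + 2) + ((e : ℂ) + 3) * y2 ^ (e + 2)) + 0 = 0 ) := by
  rintro ⟨Ha, Hb, Hx0, Hx1, Hx2, Hy0, Hy1, Hy2⟩
  let x : ℕ → ℂ := fun n => if n = 0 then x0 else if n = 1 then x1 else x2
  let y : ℕ → ℂ := fun n => if n = 0 then y0 else if n = 1 then y1 else y2
  refine sigma_member_nonsingular 3 le_rfl e he N hN a b x y ?_ ⟨?_, ?_, ?_, ?_⟩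
  · rintro ⟨h1, h2, h3⟩
    exact hne ⟨h1, h2, by simpa [x] using (h3 0 (by norm_num)).1, by simpa [x] using (h3 1 (by norm_num)).1,
      by simpa [x] using (h3 2 (by norm_num)).1, by simpa [y] using (h3 0 (by norm_num)).2,
      by simpa [y] using (h3 1 (by norm_num)).2, by simpa [y] using (h3 2 (by norm_num)).2⟩
  · simpa [x] using Ha
  · simpa [x] using Hb
  · intro i hi
    interval_cases i
    · simpa [x, y] using Hx0
    · simpa [x, y] using Hx1
    · simpa [x, y] using Hx2
  · intro j hj
    interval_cases j
    · simpa [x, y] using Hy0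
    · simpa [x, y] using Hy1
    · simpa [x, y] using Hy2

/- CONSISTENCY WITH THE ANCHOR, k′ = 4 (an `example`, as above: anchor 62's `sigma_member_k4_nonsingular` verbatim): the uniform theorem at `k = 4` yields the statement of
`sigma_member_k4_nonsingular` verbatim. -/
example (e : ℕ) (he : 1 ≤ e) (N : ℝ) (hN : 2 * (e : ℝ) + 5 ≤ N)
    (a b x0 x1 x2 x3 y0 y1 y2 y3 : ℂ)
    (hne : ¬ (a = 0 ∧ b = 0 ∧ x0 = 0 ∧ x1 = 0 ∧ x2 = 0 ∧ x3 = 0 ∧ y0 = 0 ∧ y1 = 0 ∧ y2 = 0 ∧ y3 = 0)) :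
    ¬ ( (N : ℂ) * (b * (((e : ℂ) + 2) * a ^ (e + 1) + b ^ (e + 1))) + b * x0 ^ e * x1 = 0 ∧
        (N : ℂ) * (a * (a ^ (e + 1) + ((e : ℂ) + 2) * b ^ (e + 1))) + a * x0 ^ e * x1 = 0 ∧
        (N : ℂ) * (((e : ℂ) + 2) * x0 ^ (e + 1) * y0) + (-(y2 * x3 ^ (e + 1)) + (e : ℂ) * a * b * x0 ^ (e - 1) * x1) = 0 ∧
        (N : ℂ) * (((e : ℂ) + 2) * x1 ^ (e + 1) * y1) + (-(((e : ℂ) + 1) * y0 * x1 ^ e * x2) + a * b * x0 ^ e) = 0 ∧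
        (N : ℂ) * (((e : ℂ) + 2) * x2 ^ (e + 1) * y2) + (-(y0 * x1 ^ (e + 1)) - ((e : ℂ) + 1) * y1 * x2 ^ e * x3) = 0 ∧
        (N : ℂ) * (((e : ℂ) + 2) * x3 ^ (e + 1) * y3) + (-(y1 * x2 ^ (e + 1)) - ((e : ℂ) + 1) * y2 * x0 * x3 ^ e) = 0 ∧
        (N : ℂ) * (x0 ^ (e + 2) + ((e : ℂ) + 3) * y0 ^ (e + 2)) + (-(x1 ^ (e + 1) * x2)) = 0 ∧
        (N : ℂ) * (x1 ^ (e + 2) + ((e : ℂ) + 3) * y1 ^ (e + 2)) + (-(x2 ^ (e + 1) * x3)) = 0 ∧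
        (N : ℂ) * (x2 ^ (e + 2) + ((e : ℂ) + 3) * y2 ^ (e + 2)) + (-(x0 * x3 ^ (e + 1))) = 0 ∧
        (N : ℂ) * (x3 ^ (e + 2) + ((e : ℂ) + 3) * y3 ^ (e + 2)) + 0 = 0 ) := by
  rintro ⟨Ha, Hb, Hx0, Hx1, Hx2, Hx3, Hy0, Hy1, Hy2, Hy3⟩
  let x : ℕ → ℂ := fun n => if n = 0 then x0 else if n = 1 then x1 else if n = 2 then x2 else x3
  let y : ℕ → ℂ := fun n => if n = 0 then y0 else if n = 1 then y1 else if n = 2 then y2 else y3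
  refine sigma_member_nonsingular 4 (by norm_num) e he N hN a b x y ?_ ⟨?_, ?_, ?_, ?_⟩
  · rintro ⟨h1, h2, h3⟩
    exact hne ⟨h1, h2, by simpa [x] using (h3 0 (by norm_num)).1, by simpa [x] using (h3 1 (by norm_num)).1,
      by simpa [x] using (h3 2 (by norm_num)).1, by simpa [x] using (h3 3 (by norm_num)).1,
      by simpa [y] using (h3 0 (by norm_num)).2, by simpa [y] using (h3 1 (by norm_num)).2,
      by simpa [y] using (h3 2 (by norm_num)).2, by simpa [y] using (h3 3 (by norm_num)).2⟩
  · simpa [x] using Ha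
  · simpa [x] using Hb
  · intro i hi
    interval_cases i
    · simpa [x, y] using Hx0
    · simpa [x, y] using Hx1
    · simpa [x, y] using Hx2
    · simpa [x, y] using Hx3
  · intro j hj
    interval_cases j
    · simpa [x, y] using Hy0
    · simpa [x, y] using Hy1
    · simpa [x, y] using Hy2
    · simpa [x, y] using Hy3

end Summit.HodgeConjecture.HodgeConjecture.HodgeLocus.Census.SigmaFamilySmoothAll
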